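import Literature.MathematicalPhysics.QuantumFieldTheory.Balaban1983to89.B6Ineq243TwoLevelBox
import Literature.MathematicalPhysics.QuantumFieldTheory.Balaban1983to89.B4Thm19ZeroBoxHolder

/-!
# `Balaban1983to89.B6Ineq243HolderTwoLevelBox` — the HÖLDER CLAUSE of [3] Theorem (1.9) / Lemma 2.2 (2.16) for the
GENUINE TWO-LEVEL CUBE PROPAGATOR `G′(□)` of [B6] (2.42), uniformly in the mesh (the cube-level input of the fourth entry
`‖ζ∇G′λ‖_α` of Proposition 2.2 (2.67); file 9 of the two-level parametrix; nothing existing is touched; no fact is minted;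
every input is a kernel-proved theorem of the `B4*`/`B6*` package, consumed BY NAME)

FRAMING (verbatim cell line):
statement-level skeleton of published theorems with citation tags; proofs where landed; nothing here is a claim about the Yang–Mills mass gap

Source under audit (cell pub-balaban): T. Bałaban, *Propagators and renormalization transformations for lattice gauge
theories. II*, Commun. Math. Phys. **96** (1984) 223–250 [`Balaban1984PropagatorsII`, "B6"], p. 230 [PDF 8] (2.42)–(2.43),
p. 234 [PDF 12] Proposition 2.2 (2.67) (render `b2b-balaban-ref1/pages/1984-cmp96-propagators-rt-II/…-p012-x2.png`, read
as an image this generation); [3] = T. Bałaban, *Regularity and decay of lattice Green's functions*, Commun. Math. Phys.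
**89** (1983) 571–597 [`Balaban1983RegularityDecay`, "B4"], p. 573 Theorem (1.9), p. 578 Lemma 2.2 (2.16).

## WHAT IS PRINTED

[B6] p. 230: «Properties of the operators G_j(□), G_j(□)Q_j^* and C^{(j)}(□) are described in Lemmas 2.2, 2.4, Proposition
2.3 [3]. From these and (2.42) we get |(G′(□)λ)(x)|, |(∇^{L^{−j}}G′(□)λ)(x)| ≤ O(1)e^{−δ₀dist(x, supp λ)}|λ|. (2.43)»;
p. 234: «The similar inequalities hold for a derivative of G′λ and for a Hölder norm of a derivative, but with (L^jη)²
replaced by L^jη and (L^jη)^{1−α} correspondingly», Proposition 2.2 (2.67), fourth entry `‖ζ∇G′λ‖_α ≤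
O(1)(L^jη)^{1−α}(‖ζ‖_α + |ζ|)e^{−½δ₀d(y,y′)}|λ|`.  [3] Lemma 2.2: «the inequalities (1.9), (1.10) hold for G_k(□)»,
(1.9) being the Hölder clause `|x − x′|^{−α}|(∂G f)(x) − (∂G f)(x′)| ≤ c₀e^{−δ₀dist({x,x′}, supp f)}‖f‖_∞`.

## WHAT THIS FILE CERTIFIES (kernel-checked; `A = 0`)

HONEST LABEL.  (2.43) prints the value and the derivative clause only; the HÖLDER clause for the cube propagator `G′(□)`
— the cube-level input the print uses tacitly for the fourth entry of (2.67) — is obtained here exactly as the print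
obtains (2.43): from the [3] properties of `G_j(□)` (here the Hölder clause (1.9)/(2.16) at `A = 0` for boxes,
`B4Thm19ZeroBoxHolder.thm19_zero_box_holder_roww_coeff`), of `C_Λ^{(j)}(□)` (`B4BoxCov237.cov116_box_finset_decay`) and
of `G_j(□)` (`B4Thm110ZeroBox.thm110_zero_box_roww_coeff`), through the operator identity (2.42)
(`B6Ineq243TwoLevelBox.gTwoLevel`).  In the two-centre weighted form of `B4Thm19ZeroBoxHolder` (slightly stronger than the
pointwise statement): for every `0 ≤ α < 1` there are `δ′, c′ > 0` (functions of `d`, `ℓ`, `α`, the windows) such that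
for EVERY mesh `k ≥ 1` (`n = L^k`, `ξ = 1/n`), window point, box of `L`-blocks, `Λ`, axis `μ` and all `x ≠ x′` of the box
with `x + e_μ`, `x′ + e_μ` in the box,
`Σ_z (n/|x′−x|_∞)^α·|n(((G′(□)(x′+e_μ,z) − G′(□)(x′,z)) − (G′(□)(x+e_μ,z) − G′(□)(x,z)))|·e^{δ′min(|x−z|,|x′−z|)/n} ≤ c′`
(`ineq243_twoLevel_holder_wsum2`), and the printed Hölder form with `‖f‖_∞` and `dist({x,x′}, supp f)`
(`ineq243_twoLevel_holder_value`).  Tools: the two-centre vector–matrix submultiplicativity `wsum2_vecMul_le` and the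
doubly-differenced row identity `row_dd_add_smul_mul` (both reused by the box-level fourth entry).

Value = kernel certificate of the Hölder clause for the genuine two-level cube propagator at `A = 0`, uniformly in the
mesh; NOT summit progress (the Yang–Mills statements are untouched).
-/

namespace Literature.MathematicalPhysics.QuantumFieldTheory.Balaban1983to89.B6Ineq243HolderTwoLevelBox

open Finset Matrix
open Literature.MathematicalPhysics.QuantumFieldTheory.Balaban1983to89.B4ContourShift
open Literature.MathematicalPhysics.QuantumFieldTheory.Balaban1983to89.B4Reflection242
open Literature.MathematicalPhysics.QuantumFieldTheory.Balaban1983to89.B4Green242Bridge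
open Literature.MathematicalPhysics.QuantumFieldTheory.Balaban1983to89.B4BoxCov237
open Literature.MathematicalPhysics.QuantumFieldTheory.Balaban1983to89.B4Thm110ZeroBox
open Literature.MathematicalPhysics.QuantumFieldTheory.Balaban1983to89.B4Thm110ZeroBoxDeriv
open Literature.MathematicalPhysics.QuantumFieldTheory.Balaban1983to89.B4Thm19ZeroBoxHolder
open Literature.MathematicalPhysics.QuantumFieldTheory.Balaban1983to89.B6Ineq243TwoLevelBox
open B4Sect5Proof (latticeConst latticeConst_nonneg)

noncomputable section

variable {d : ℕ}

/-! ## §1 Two-centre bookkeeping: vector–matrix submultiplicativity, the doubly differenced row of (2.42) -/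

section Tools

variable {N : Fin (d + 1) → ℕ}

/-- **VECTOR–MATRIX SUBMULTIPLICATIVITY OF THE TWO-CENTRE FUNCTIONAL**: for a vector `g` about the pair `x, x′` and a
kernel `B` with weighted rows `≤ R`, `wsum2_{x,x′}(g·B) ≤ wsum2_{x,x′}(g)·R`
(`min(|x−z|,|x′−z|) ≤ min(|x−y|,|x′−y|) + |y−z|`). [cite: Balaban1984PropagatorsII, (2.42)–(2.43) p.230, bookkeeping] -/
theorem wsum2_vecMul_le {δ : ℝ} (hδ : 0 ≤ δ) (n : ℕ) (x x' : ↥(boxDom N)) (g : ↥(boxDom N) → ℝ)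
    (B : Matrix ↥(boxDom N) ↥(boxDom N) ℝ) {R : ℝ} (hB : ∀ y, roww δ n B y ≤ R) :
    wsum2 δ n x x' (fun z => ∑ y, g y * B y z) ≤ wsum2 δ n x x' g * R := by
  unfold wsum2
  unfold roww at hB
  have hw : ∀ y z : ↥(boxDom N), Real.exp (δ * min (supNorm (x.1 - z.1)) (supNorm (x'.1 - z.1)) / n)
      ≤ Real.exp (δ * min (supNorm (x.1 - y.1)) (supNorm (x'.1 - y.1)) / n)
        * Real.exp (δ * supNorm (y.1 - z.1) / n) := by
    intro y z
    rw [← Real.exp_add]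
    apply Real.exp_le_exp.2
    rw [← add_div, ← mul_add]
    refine div_le_div_of_nonneg_right (mul_le_mul_of_nonneg_left ?_ hδ) (Nat.cast_nonneg n)
    rw [← min_add_add_right]
    exact min_le_min (supNorm_sub_le_sub_add_sub _ _ _) (supNorm_sub_le_sub_add_sub _ _ _)
  calc ∑ z, |∑ y, g y * B y z| * Real.exp (δ * min (supNorm (x.1 - z.1)) (supNorm (x'.1 - z.1)) / n)
      ≤ ∑ z, ∑ y, |g y| * Real.exp (δ * min (supNorm (x.1 - y.1)) (supNorm (x'.1 - y.1)) / n)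
          * (|B y z| * Real.exp (δ * supNorm (y.1 - z.1) / n)) := by
        refine Finset.sum_le_sum fun z _ => ?_
        calc |∑ y, g y * B y z| * Real.exp (δ * min (supNorm (x.1 - z.1)) (supNorm (x'.1 - z.1)) / n)
            ≤ (∑ y, |g y| * |B y z|) * Real.exp (δ * min (supNorm (x.1 - z.1)) (supNorm (x'.1 - z.1)) / n) := by
              refine mul_le_mul_of_nonneg_right ?_ (Real.exp_pos _).le
              exact (Finset.abs_sum_le_sum_abs _ _).trans
                (le_of_eq (Finset.sum_congr rfl fun _ _ => abs_mul _ _))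
          _ = ∑ y, |g y| * |B y z| * Real.exp (δ * min (supNorm (x.1 - z.1)) (supNorm (x'.1 - z.1)) / n) :=
              Finset.sum_mul _ _ _
          _ ≤ _ := Finset.sum_le_sum fun y _ => by
              calc |g y| * |B y z| * Real.exp (δ * min (supNorm (x.1 - z.1)) (supNorm (x'.1 - z.1)) / n)
                  ≤ |g y| * |B y z| * (Real.exp (δ * min (supNorm (x.1 - y.1)) (supNorm (x'.1 - y.1)) / n)
                      * Real.exp (δ * supNorm (y.1 - z.1) / n)) :=
                    mul_le_mul_of_nonneg_left (hw y z) (mul_nonneg (abs_nonneg _) (abs_nonneg _))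
                _ = _ := by ring
    _ = ∑ y, |g y| * Real.exp (δ * min (supNorm (x.1 - y.1)) (supNorm (x'.1 - y.1)) / n)
          * ∑ z, |B y z| * Real.exp (δ * supNorm (y.1 - z.1) / n) := by
        rw [Finset.sum_comm]
        exact Finset.sum_congr rfl fun y _ => (Finset.mul_sum _ _ _).symm
    _ ≤ ∑ y, |g y| * Real.exp (δ * min (supNorm (x.1 - y.1)) (supNorm (x'.1 - y.1)) / n) * R :=
        Finset.sum_le_sum fun y _ =>
          mul_le_mul_of_nonneg_left (hB y) (mul_nonneg (abs_nonneg _) (Real.exp_pos _).le)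
    _ = (∑ y, |g y| * Real.exp (δ * min (supNorm (x.1 - y.1)) (supNorm (x'.1 - y.1)) / n)) * R :=
        (Finset.sum_mul _ _ _).symm

/-- doubly differencing the rows of `G + c·G·B` over four points, with a weight `W` and a scale `t`:
`W·t·dd(G + cGB) = W·t·ddG + c·(W·t·ddG)·B`. [cite: Balaban1984PropagatorsII, (2.42)–(2.43) p.230, bookkeeping] -/
theorem row_dd_add_smul_mul (G B : Matrix ↥(boxDom N) ↥(boxDom N) ℝ) (c W t : ℝ) (p' q' p q z : ↥(boxDom N)) :
    W * (t * (((G + c • (G * B)) p' z - (G + c • (G * B)) q' z) - ((G + c • (G * B)) p z - (G + c • (G * B)) q z)))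
      = W * (t * ((G p' z - G q' z) - (G p z - G q z)))
        + c * ∑ y, (W * (t * ((G p' y - G q' y) - (G p y - G q y)))) * B y z := by
  simp only [Matrix.add_apply, Matrix.smul_apply, Matrix.mul_apply, smul_eq_mul]
  have : ∑ y, (W * (t * ((G p' y - G q' y) - (G p y - G q y)))) * B y z
      = W * (t * ((∑ y, G p' y * B y z - ∑ y, G q' y * B y z) - (∑ y, G p y * B y z - ∑ y, G q y * B y z))) := by
    rw [← Finset.sum_sub_distrib, ← Finset.sum_sub_distrib, ← Finset.sum_sub_distrib, Finset.mul_sum,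
      Finset.mul_sum]
    exact Finset.sum_congr rfl fun y _ => by ring
  rw [this]
  ring

end Tools

/-! ## §2 The deterministic assembly through (2.42) -/

/-- **THE DETERMINISTIC ASSEMBLY, HÖLDER CLAUSE**: a weighted row bound `c₀` for `G_j(□)` (rate `δ₀`), a two-centre
bound `c₁` for the weighted doubly differenced row `W·n·((G_j(□)(p′,·) − G_j(□)(q′,·)) − (G_j(□)(p,·) − G_j(□)(q,·)))`
about `q, q′` (rate `δ₁`) and the entry decay of `C_Λ^{(j)}(□)` (rate `δ`, constant `c`) give, for
`0 ≤ δ′ ≤ min(δ₀, δ₁, δ/2)`, the same two-centre bound for `G′(□)` with constant `c₁ + a_j²·c₁(ce^{δ′}K_{d+1}(δ/2))c₀`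
(`W` an arbitrary real weight, e.g. the Hölder weight `(n/|q′−q|_∞)^α`). [cite: Balaban1984PropagatorsII, (2.42)–(2.43) p.230] -/
theorem gTwoLevel_holder_wsum2_le {n ℓ : ℕ} (hn : 1 ≤ n) (aj a m2 : ℝ) {M' : Fin (d + 1) → ℕ}
    (Λ : Finset ↥(boxDom (fun i => (ℓ + 1) * M' i))) {δ₀ c₀ δ₁ c₁ δ c δ' : ℝ}
    (hc₀ : 0 ≤ c₀) (hc : 0 ≤ c) (hδ : 0 < δ) (hδ'0 : 0 ≤ δ') (hδ'1 : δ' ≤ δ₀) (hδ'3 : δ' ≤ δ₁)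
    (hδ'2 : δ' ≤ δ / 2)
    (hG : ∀ z, roww δ₀ n (boxOpR n aj m2 (fun i => (ℓ + 1) * M' i))⁻¹ z ≤ c₀)
    (hC : ∀ y y' : ↥Λ, |cΛ n ℓ aj a m2 M' Λ y y'| ≤ c * Real.exp (-(δ * supNorm (y.1.1 - y'.1.1))))
    (W : ℝ) (q p q' p' : ↥(boxDom (fun i => n * ((ℓ + 1) * M' i))))
    (hD : wsum2 δ₁ n q q' (fun z => W * ((n : ℝ) * (((boxOpR n aj m2 (fun i => (ℓ + 1) * M' i))⁻¹ p' z
        - (boxOpR n aj m2 (fun i => (ℓ + 1) * M' i))⁻¹ q' z) - ((boxOpR n aj m2 (fun i => (ℓ + 1) * M' i))⁻¹ p z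
        - (boxOpR n aj m2 (fun i => (ℓ + 1) * M' i))⁻¹ q z)))) ≤ c₁) :
    wsum2 δ' n q q' (fun z => W * ((n : ℝ) * ((gTwoLevel n ℓ aj a m2 M' Λ p' z - gTwoLevel n ℓ aj a m2 M' Λ q' z)
        - (gTwoLevel n ℓ aj a m2 M' Λ p z - gTwoLevel n ℓ aj a m2 M' Λ q z))))
      ≤ c₁ + aj ^ 2 * (c₁ * (c * Real.exp δ' * latticeConst (d + 1) (δ / 2)) * c₀) := by
  have hn' : (0 : ℝ) < n := by exact_mod_cast hn
  have hnD : (0 : ℝ) < ((n : ℝ)) ^ (d + 1) := by positivity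
  have hc₁ : 0 ≤ c₁ := (wsum2_nonneg _ _ _ _ _).trans hD
  have hGrow : ∀ z, roww δ' n (boxOpR n aj m2 (fun i => (ℓ + 1) * M' i))⁻¹ z ≤ c₀ :=
    fun z => (roww_mono hδ'1 n _ z).trans (hG z)
  have hmid : ∀ z, roww δ' n ((indBΛ n Λ)ᵀ * cΛ n ℓ aj a m2 M' Λ * indBΛ n Λ) z
      ≤ c * Real.exp δ' * (((n : ℝ)) ^ (d + 1) * latticeConst (d + 1) (δ / 2)) :=
    fun z => roww_mid_le hn Λ hc hδ hδ'0 hδ'2 hC z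
  have hK0 : 0 ≤ c * Real.exp δ' * (((n : ℝ)) ^ (d + 1) * latticeConst (d + 1) (δ / 2)) := by
    have := latticeConst_nonneg (d + 1) (half_pos hδ).le
    positivity
  have hMG : ∀ z, roww δ' n ((indBΛ n Λ)ᵀ * cΛ n ℓ aj a m2 M' Λ * indBΛ n Λ
      * (boxOpR n aj m2 (fun i => (ℓ + 1) * M' i))⁻¹) z
      ≤ c * Real.exp δ' * (((n : ℝ)) ^ (d + 1) * latticeConst (d + 1) (δ / 2)) * c₀ :=
    fun z => (roww_mul_le hδ'0 n _ _ hGrow z).trans (mul_le_mul_of_nonneg_right (hmid z) hc₀)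
  have hD' : wsum2 δ' n q q' (fun z => W * ((n : ℝ) * (((boxOpR n aj m2 (fun i => (ℓ + 1) * M' i))⁻¹ p' z
        - (boxOpR n aj m2 (fun i => (ℓ + 1) * M' i))⁻¹ q' z) - ((boxOpR n aj m2 (fun i => (ℓ + 1) * M' i))⁻¹ p z
        - (boxOpR n aj m2 (fun i => (ℓ + 1) * M' i))⁻¹ q z)))) ≤ c₁ := (wsum2_mono_rate hδ'3 n q q' _).trans hD
  have hassoc : gTwoLevel n ℓ aj a m2 M' Λ = (boxOpR n aj m2 (fun i => (ℓ + 1) * M' i))⁻¹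
      + (aj ^ 2 * (((n : ℝ)) ^ (d + 1))⁻¹) • ((boxOpR n aj m2 (fun i => (ℓ + 1) * M' i))⁻¹
        * ((indBΛ n Λ)ᵀ * cΛ n ℓ aj a m2 M' Λ * indBΛ n Λ * (boxOpR n aj m2 (fun i => (ℓ + 1) * M' i))⁻¹)) := by
    unfold gTwoLevel
    simp only [Matrix.mul_assoc]
  simp_rw [hassoc, row_dd_add_smul_mul]
  set G := (boxOpR n aj m2 (fun i => (ℓ + 1) * M' i))⁻¹ with hGdef
  set B := (indBΛ n Λ)ᵀ * cΛ n ℓ aj a m2 M' Λ * indBΛ n Λ * G with hBdef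
  calc wsum2 δ' n q q' (fun z => W * ((n : ℝ) * ((G p' z - G q' z) - (G p z - G q z)))
          + aj ^ 2 * (((n : ℝ)) ^ (d + 1))⁻¹ * ∑ y, (W * ((n : ℝ) * ((G p' y - G q' y) - (G p y - G q y)))) * B y z)
      ≤ wsum2 δ' n q q' (fun z => W * ((n : ℝ) * ((G p' z - G q' z) - (G p z - G q z))))
        + wsum2 δ' n q q' (fun z => aj ^ 2 * (((n : ℝ)) ^ (d + 1))⁻¹
            * ∑ y, (W * ((n : ℝ) * ((G p' y - G q' y) - (G p y - G q y)))) * B y z) := wsum2_add_le _ _ _ _ _ _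
    _ ≤ c₁ + aj ^ 2 * (((n : ℝ)) ^ (d + 1))⁻¹
        * (c₁ * (c * Real.exp δ' * (((n : ℝ)) ^ (d + 1) * latticeConst (d + 1) (δ / 2)) * c₀)) := by
        have h2nd : wsum2 δ' n q q' (fun z => aj ^ 2 * (((n : ℝ)) ^ (d + 1))⁻¹
            * ∑ y, (W * ((n : ℝ) * ((G p' y - G q' y) - (G p y - G q y)))) * B y z)
            ≤ aj ^ 2 * (((n : ℝ)) ^ (d + 1))⁻¹
              * (c₁ * (c * Real.exp δ' * (((n : ℝ)) ^ (d + 1) * latticeConst (d + 1) (δ / 2)) * c₀)) := by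
          rw [wsum2_mul_left _ _ _ _ (by positivity)]
          exact mul_le_mul_of_nonneg_left
            ((wsum2_vecMul_le hδ'0 n q q' _ _ hMG).trans (mul_le_mul_of_nonneg_right hD' (mul_nonneg hK0 hc₀)))
            (by positivity)
        exact add_le_add hD' h2nd
    _ = c₁ + aj ^ 2 * (c₁ * (c * Real.exp δ' * latticeConst (d + 1) (δ / 2)) * c₀) := by
        field_simp

/-! ## §3 The Hölder clause for `G′(□)`, uniformly in the mesh -/

/-- **THE HÖLDER CLAUSE OF [3] (1.9)/(2.16) FOR THE GENUINE TWO-LEVEL CUBE PROPAGATOR `G′(□)` OF (2.42), UNIFORMLY IN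
THE MESH — two-centre weighted form.**  For every dimension, block size, windows and `0 ≤ α < 1` there are `δ′, c′ > 0`
such that for EVERY `j ≥ 1` (`n = L^j`, `ξ = L^{−j} = 1/n`), every point of the windows, every box built of `L`-blocks,
EVERY `Λ ⊆ □^{(j)}`, every axis `μ` and all `x ≠ x′` of `□` with `x + e_μ, x′ + e_μ ∈ □`:
`Σ_{z ∈ □} (n/|x′−x|_∞)^α·|n(((G′(□)(x′+e_μ,z) − G′(□)(x′,z)) − (G′(□)(x+e_μ,z) − G′(□)(x,z)))|·e^{δ′min(|x−z|_∞,|x′−z|_∞)/n} ≤ c′`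
(`(ξ|x′−x|_∞)^{−α}·|(∂^ξ_μG′(□)(·,z))(x′) − (∂^ξ_μG′(□)(·,z))(x)|` summed against the two-centre weight).  Inputs BY
NAME: `B4Thm19ZeroBoxHolder.thm19_zero_box_holder_roww_coeff` ([3] Theorem (1.9), Hölder clause, at `A = 0` for boxes,
literal coefficient), `B4Thm110ZeroBox.thm110_zero_box_roww_coeff`, `B4BoxCov237.cov116_box_finset_decay`.  HONEST
LABEL: (2.43) prints the value/derivative clauses; this is the Hölder companion obtained by the same sentence («From these
and (2.42) we get …») and consumed by the fourth entry of (2.67).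
[cite: Balaban1984PropagatorsII, (2.42)–(2.43) p.230, Proposition 2.2 (2.67) p.234; Balaban1983RegularityDecay, Theorem (1.9) p.573, Lemma 2.2 (2.16) p.578] -/
theorem ineq243_twoLevel_holder_wsum2 (d ℓ : ℕ) (hℓ : 1 ≤ ℓ) (aminus aplus m2plus a2minus a2plus : ℝ)
    (ha : 0 < aminus) (ha2 : 0 < a2minus) (α : ℝ) (hα0 : 0 ≤ α) (hα1 : α < 1) :
    ∃ δ' c' : ℝ, 0 < δ' ∧ 0 < c' ∧ ∀ (k : ℕ), 1 ≤ k → ∀ (aj m2 a : ℝ), aminus ≤ aj → aj ≤ aplus → 0 ≤ m2 →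
      m2 ≤ m2plus → a2minus ≤ a → a ≤ a2plus → ∀ (M' : Fin (d + 1) → ℕ), (∀ i, 1 ≤ M' i) →
        ∀ (Λ : Finset ↥(boxDom (fun i => (ℓ + 1) * M' i))) (μ : Fin (d + 1))
          (x xe x' xe' : ↥(boxDom (fun i => (ℓ + 1) ^ k * ((ℓ + 1) * M' i)))),
          xe.1 = x.1 + Pi.single μ 1 → xe'.1 = x'.1 + Pi.single μ 1 → x'.1 ≠ x.1 →
          ∑ z, |((((ℓ + 1) ^ k : ℕ) : ℝ) / supNorm (x'.1 - x.1)) ^ α * ((((ℓ + 1) ^ k : ℕ) : ℝ)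
                * ((gTwoLevel ((ℓ + 1) ^ k) ℓ aj a m2 M' Λ xe' z - gTwoLevel ((ℓ + 1) ^ k) ℓ aj a m2 M' Λ x' z)
                  - (gTwoLevel ((ℓ + 1) ^ k) ℓ aj a m2 M' Λ xe z - gTwoLevel ((ℓ + 1) ^ k) ℓ aj a m2 M' Λ x z)))|
              * Real.exp (δ' * min (supNorm (x.1 - z.1)) (supNorm (x'.1 - z.1)) / (((ℓ + 1) ^ k : ℕ) : ℝ))
            ≤ c' := by
  obtain ⟨δ₀, c₀, hδ₀, hc₀, hG⟩ := thm110_zero_box_roww_coeff d ℓ hℓ aminus aplus m2plus ha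
  obtain ⟨δ₁, c₁, hδ₁, hc₁, hGH⟩ := thm19_zero_box_holder_roww_coeff d ℓ hℓ aminus aplus m2plus ha α hα0 hα1
  obtain ⟨δ, c, hδ, hc, hC⟩ := cov116_box_finset_decay d ℓ hℓ aminus aplus m2plus a2minus a2plus ha ha2
  have hδ'pos : 0 < min (min δ₀ δ₁) (δ / 2) := lt_min (lt_min hδ₀ hδ₁) (half_pos hδ)
  have hKn : 0 ≤ latticeConst (d + 1) (δ / 2) := latticeConst_nonneg (d + 1) (half_pos hδ).le
  refine ⟨min (min δ₀ δ₁) (δ / 2),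
    c₁ + aplus ^ 2 * (c₁ * (c * Real.exp (min (min δ₀ δ₁) (δ / 2)) * latticeConst (d + 1) (δ / 2)) * c₀),
    hδ'pos, by positivity, ?_⟩
  intro k hk aj m2 a h1 h2 h3 h4 h5 h6 M' hM Λ μ x xe x' xe' hxe hxe' hne
  have hn1 : 1 ≤ (ℓ + 1) ^ k := Nat.one_le_pow _ _ (by omega)
  have hMℓ : ∀ i, 1 ≤ (ℓ + 1) * M' i := fun i => by nlinarith [hM i]
  have haj : 0 < aj := lt_of_lt_of_le ha h1
  have hGz : ∀ z, roww δ₀ ((ℓ + 1) ^ k) (boxOpR ((ℓ + 1) ^ k) aj m2 (fun i => (ℓ + 1) * M' i))⁻¹ z ≤ c₀ :=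
    fun z => hG k hk aj m2 h1 h2 h3 h4 (fun i => (ℓ + 1) * M' i) hMℓ z
  have hGHx : wsum2 δ₁ ((ℓ + 1) ^ k) x x' (fun z => ((((ℓ + 1) ^ k : ℕ) : ℝ) / supNorm (x'.1 - x.1)) ^ α
      * (((((ℓ + 1) ^ k : ℕ)) : ℝ) * (((boxOpR ((ℓ + 1) ^ k) aj m2 (fun i => (ℓ + 1) * M' i))⁻¹ xe' z
        - (boxOpR ((ℓ + 1) ^ k) aj m2 (fun i => (ℓ + 1) * M' i))⁻¹ x' z)
        - ((boxOpR ((ℓ + 1) ^ k) aj m2 (fun i => (ℓ + 1) * M' i))⁻¹ xe z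
        - (boxOpR ((ℓ + 1) ^ k) aj m2 (fun i => (ℓ + 1) * M' i))⁻¹ x z)))) ≤ c₁ :=
    hGH k hk aj m2 h1 h2 h3 h4 (fun i => (ℓ + 1) * M' i) hMℓ μ x xe x' xe' hxe hxe' hne
  have hCz := (hC ((ℓ + 1) ^ k) hn1 aj m2 a h1 h2 h3 h4 h5 h6 M' hM Λ).2
  have hmain := gTwoLevel_holder_wsum2_le hn1 aj a m2 Λ hc₀.le hc.le hδ hδ'pos.le
    ((min_le_left _ _).trans (min_le_left _ _)) ((min_le_left _ _).trans (min_le_right _ _))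
    (min_le_right _ _) hGz hCz _ x xe x' xe' hGHx
  rw [wsum2] at hmain
  refine hmain.trans ?_
  have : aj ^ 2 ≤ aplus ^ 2 := pow_le_pow_left₀ haj.le h2 2
  have h0 : 0 ≤ c₁ * (c * Real.exp (min (min δ₀ δ₁) (δ / 2)) * latticeConst (d + 1) (δ / 2)) * c₀ := by
    positivity
  nlinarith

/-- **THE PRINTED HÖLDER FORM FOR `G′(□)`**: `(ξ|x′−x|_∞)^{−α}|((∂^ξ_μG′(□)f)(x′) − (∂^ξ_μG′(□)f)(x))| ≤
c′e^{−δ′ξD}‖f‖_∞` for every `f`, every `F ≥ |f|` and every `D ≤ min(|x−z|_∞, |x′−z|_∞)` on `supp f`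
(`ξD ≤ dist({x,x′}, supp f)`), uniformly in the mesh — the Hölder companion of (2.43) in the form of [3] (1.9).
[cite: Balaban1984PropagatorsII, (2.43) p.230, Proposition 2.2 (2.67) p.234; Balaban1983RegularityDecay, Theorem (1.9) p.573] -/
theorem ineq243_twoLevel_holder_value (d ℓ : ℕ) (hℓ : 1 ≤ ℓ) (aminus aplus m2plus a2minus a2plus : ℝ)
    (ha : 0 < aminus) (ha2 : 0 < a2minus) (α : ℝ) (hα0 : 0 ≤ α) (hα1 : α < 1) :
    ∃ δ' c' : ℝ, 0 < δ' ∧ 0 < c' ∧ ∀ (k : ℕ), 1 ≤ k → ∀ (aj m2 a : ℝ), aminus ≤ aj → aj ≤ aplus → 0 ≤ m2 →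
      m2 ≤ m2plus → a2minus ≤ a → a ≤ a2plus → ∀ (M' : Fin (d + 1) → ℕ), (∀ i, 1 ≤ M' i) →
        ∀ (Λ : Finset ↥(boxDom (fun i => (ℓ + 1) * M' i)))
          (f : ↥(boxDom (fun i => (ℓ + 1) ^ k * ((ℓ + 1) * M' i))) → ℝ) (F D : ℝ), (∀ z, |f z| ≤ F) →
          ∀ (μ : Fin (d + 1)) (x xe x' xe' : ↥(boxDom (fun i => (ℓ + 1) ^ k * ((ℓ + 1) * M' i)))),
          xe.1 = x.1 + Pi.single μ 1 → xe'.1 = x'.1 + Pi.single μ 1 → x'.1 ≠ x.1 →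
          (∀ z, f z ≠ 0 → D ≤ min (supNorm (x.1 - z.1)) (supNorm (x'.1 - z.1))) →
          ((((ℓ + 1) ^ k : ℕ) : ℝ) / supNorm (x'.1 - x.1)) ^ α *
            |(((ℓ + 1) ^ k : ℕ) : ℝ) *
              (((gTwoLevel ((ℓ + 1) ^ k) ℓ aj a m2 M' Λ *ᵥ f) xe' - (gTwoLevel ((ℓ + 1) ^ k) ℓ aj a m2 M' Λ *ᵥ f) x')
                - ((gTwoLevel ((ℓ + 1) ^ k) ℓ aj a m2 M' Λ *ᵥ f) xe - (gTwoLevel ((ℓ + 1) ^ k) ℓ aj a m2 M' Λ *ᵥ f) x))|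
            ≤ c' * Real.exp (-(δ' * D / (((ℓ + 1) ^ k : ℕ) : ℝ))) * F := by
  obtain ⟨δ', c', hδ', hc', h⟩ :=
    ineq243_twoLevel_holder_wsum2 d ℓ hℓ aminus aplus m2plus a2minus a2plus ha ha2 α hα0 hα1
  refine ⟨δ', c', hδ', hc', ?_⟩
  intro k hk aj m2 a h1 h2 h3 h4 h5 h6 M' hM Λ f F D hF μ x xe x' xe' hxe hxe' hne hD
  have hW0 : 0 ≤ ((((ℓ + 1) ^ k : ℕ) : ℝ) / supNorm (x'.1 - x.1)) ^ α :=
    Real.rpow_nonneg (div_nonneg (Nat.cast_nonneg _) (supNorm_nonneg _)) α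
  rw [← abs_of_nonneg hW0, ← abs_mul, mulVec_dd]
  exact abs_sum_mul_le_of_wsum2 hδ'.le _ x x' _
    (h k hk aj m2 a h1 h2 h3 h4 h5 h6 M' hM Λ μ x xe x' xe' hxe hxe' hne) f hF hD

/-! ## §4 Non-vacuity -/

/-- the hypotheses of the Hölder clause are inhabited: `d + 1 = 4`, `L = 2`, unit windows, `α = 1/2`.
[cite: Balaban1984PropagatorsII, (2.43) p.230] -/
example : ∃ δ' c' : ℝ, 0 < δ' ∧ 0 < c' ∧ ∀ (k : ℕ), 1 ≤ k → ∀ (aj m2 a : ℝ), (1 : ℝ) ≤ aj → aj ≤ 1 → 0 ≤ m2 →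
      m2 ≤ 1 → (1 : ℝ) ≤ a → a ≤ 1 → ∀ (M' : Fin (3 + 1) → ℕ), (∀ i, 1 ≤ M' i) →
        ∀ (Λ : Finset ↥(boxDom (fun i => (1 + 1) * M' i))) (μ : Fin (3 + 1))
          (x xe x' xe' : ↥(boxDom (fun i => (1 + 1) ^ k * ((1 + 1) * M' i)))),
          xe.1 = x.1 + Pi.single μ 1 → xe'.1 = x'.1 + Pi.single μ 1 → x'.1 ≠ x.1 →
          ∑ z, |((((1 + 1) ^ k : ℕ) : ℝ) / supNorm (x'.1 - x.1)) ^ (1 / 2 : ℝ) * ((((1 + 1) ^ k : ℕ) : ℝ)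
                * ((gTwoLevel ((1 + 1) ^ k) 1 aj a m2 M' Λ xe' z - gTwoLevel ((1 + 1) ^ k) 1 aj a m2 M' Λ x' z)
                  - (gTwoLevel ((1 + 1) ^ k) 1 aj a m2 M' Λ xe z - gTwoLevel ((1 + 1) ^ k) 1 aj a m2 M' Λ x z)))|
              * Real.exp (δ' * min (supNorm (x.1 - z.1)) (supNorm (x'.1 - z.1)) / (((1 + 1) ^ k : ℕ) : ℝ))
            ≤ c' :=
  ineq243_twoLevel_holder_wsum2 3 1 le_rfl 1 1 1 1 1 one_pos one_pos (1 / 2) (by norm_num) (by norm_num)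

end

end Literature.MathematicalPhysics.QuantumFieldTheory.Balaban1983to89.B6Ineq243HolderTwoLevelBox
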